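/-
Origin: expansion seat `planner-pub-hodgecm-pv10-g3-0`, handover #6 2026-08-18T09:11:11Z (`HOME/pub-hodgecm-pv10-g3/lean/Pv10g3/GodementEndState.lean`, md5 08ed815b, 166 lines);
landed by the gen-7 packager in gate run 27 as `HodgeCM/PerL34/GodementEndState.lean` (import ^import Pv10g3\.→import HodgeCM.PerL34. ×1).
-/
/-
Copyright (c) 2026. All rights reserved.
Released under Apache 2.0 license as described in the file LICENSE.
-/
import Summits.HodgeConjecture.HodgeCM.PerL34.GodementCompact_2
import Summits.HodgeConjecture.HodgeCM.Automorphic.AdelicTorusThetaData_2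

/-!
# The ADELIC END STATE with the compactness criterion discharged

`HodgeCM.Automorphic.AdelicUnitaryModel` / `AdelicTorusThetaData` carry ONE group-theoretic hypothesis,
`hP : HodgeCM.PrintFact_unitaryCompact` (compactness of `[U(H)] = U(H)(L⁺)\U(H)(𝔸_{L⁺})` for hermitian
anisotropic `H`), threaded through `HermSpace3.latticeModel hP`, `SeesawDatum.latticeModelW hP`,
`AdelicModelThetaData hP`, `AdelicTorusThetaData hP` and the three END-STATE theorems
`Assembly.{realisationExists, perL, COR_CM_endState}_ofAdelicTorusData`.

`HodgeCM.PerL34.GodementCompact` PROVES that hypothesis (`HodgeCM.printFact_unitaryCompact_holds`, kernel,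
standard axioms).  This additive leaf records the instantiated, HYPOTHESIS-FREE forms — nothing in the tree
is edited; every declaration below is a one-line specialisation at `hP := printFact_unitaryCompact_holds`:

* `adelicQuotientCompact_of_isAnisotropic` — `[U(H)]` compact for every anisotropic `H ∈ M_n(L)` (no
  hermitian hypothesis is needed by the proof);
* `HermSpace3.latticeModel₀ V`, `StubTree.SeesawDatum.latticeModelW₀ S` — the core-side / theta-side
  cocompact lattice models `G_U(𝔸_{L⁺}) ⊃ G_U(L⁺)`, `U(W)(𝔸_{L₀}) ⊃ U(W)(L₀)` with NO hypothesis;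
* `Universe.AdelicTorusThetaData₀ U := U.AdelicTorusThetaData printFact_unitaryCompact_holds`;
* `Assembly.realisationExists_ofAdelicTorusData₀`, `Assembly.perL_ofAdelicTorusData₀`,
  `Assembly.COR_CM_endState_ofAdelicTorusData₀` — the END STATE over the adelic unitary groups with
  PerL's tori, whose remaining binders are `ModelAxioms`, (for COR-CM) M29/M30 and the three [QW8] facts,
  the theta DATA `D` with its analytic inputs `A12`, `A34`, `A`, and `Fact_hodgeRiemann20` — and no
  `PrintFact_unitaryCompact`.
-/

set_option autoImplicit false

noncomputable section

namespace HodgeCM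

open Literature.AlgebraicGeometry.ShimuraVarieties

/-- **`[U(H)]` is compact for every anisotropic `H ∈ M_n(L)`** (`L` a CM field, `c` the CM conjugation):
the tree's `AdelicQuotientCompact L H`, now a theorem.  (The hermitian hypothesis of
`PrintFact_unitaryCompact` is not used by the proof.) -/
theorem adelicQuotientCompact_of_isAnisotropic (L : CMField) {n : ℕ} (H : Matrix (Fin n) (Fin n) L)
    (h : IsAnisotropic L H) : AdelicQuotientCompact L H :=
  PerL34.Godement.compactSpace_adelicUnitaryQuot (L := L) H h

/-- `PrintFact_unitaryCompact` holds (re-export under the `Adelic` vocabulary of the model file). -/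
theorem adelicQuotientCompact_of_isHermitian_of_isAnisotropic (L : CMField) {n : ℕ}
    (H : Matrix (Fin n) (Fin n) L) (hH : ∀ i j, conjRingHomK L (H i j) = H j i)
    (h : IsAnisotropic L H) : AdelicQuotientCompact L H :=
  printFact_unitaryCompact_holds L n H hH h

/-- **The core-side lattice model of a hermitian space, hypothesis-free**: `G_U(𝔸_{L⁺}) ⊃ G_U(L⁺)` in PerL's
regime (`HermSpace3.latticeModel` at `hP := printFact_unitaryCompact_holds`).  Reducible. -/
abbrev HermSpace3.latticeModel₀ {L : CMField} {ι₁ : L →+* ℂ} (V : HermSpace3 L ι₁) :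
    CocompactLatticeModel :=
  V.latticeModel printFact_unitaryCompact_holds

/-- (Ported verbatim from the HodgeCMPerL package; no docstring in the source.) -/
@[simp] theorem HermSpace3.latticeModel₀_G {L : CMField} {ι₁ : L →+* ℂ} (V : HermSpace3 L ι₁) :
    V.latticeModel₀.G = ↥(Adelic.regimeSubgroup L V.Hm) := rfl

/-- (Ported verbatim from the HodgeCMPerL package; no docstring in the source.) -/
@[simp] theorem HermSpace3.latticeModel₀_Γ {L : CMField} {ι₁ : L →+* ℂ} (V : HermSpace3 L ι₁) :
    V.latticeModel₀.Γ = Adelic.regimeRat L V.Hm := rfl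

/-- In PerL's regime (`[L:ℚ] ≥ 4`) the hypothesis-free core-side model group IS `G_U(𝔸_{L⁺})`. -/
def HermSpace3.latticeModel₀Equiv {L : CMField} {ι₁ : L →+* ℂ} (V : HermSpace3 L ι₁)
    (h4 : 4 ≤ Module.finrank ℚ L) : Adelic.adelicUnitaryGroup L V.Hm ≃ₜ* V.latticeModel₀.G :=
  V.latticeModelEquiv printFact_unitaryCompact_holds h4

/-- **The theta-side lattice model of a seesaw datum, hypothesis-free**: `U(W)(𝔸_{L₀}) ⊃ U(W)(L₀)` for
`W = diag(a₀, a₁)` (`SeesawDatum.latticeModelW` at `hP := printFact_unitaryCompact_holds`).  Reducible. -/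
abbrev StubTree.SeesawDatum.latticeModelW₀ {L : CMField} (S : StubTree.SeesawDatum L) :
    CocompactLatticeModel :=
  S.latticeModelW printFact_unitaryCompact_holds

/-- (Ported verbatim from the HodgeCMPerL package; no docstring in the source.) -/
@[simp] theorem StubTree.SeesawDatum.latticeModelW₀_G {L : CMField} (S : StubTree.SeesawDatum L) :
    S.latticeModelW₀.G = ↥(Adelic.regimeSubgroup L (Matrix.diagonal ![S.a 0, S.a 1])) := rfl

/-- (Ported verbatim from the HodgeCMPerL package; no docstring in the source.) -/
@[simp] theorem StubTree.SeesawDatum.latticeModelW₀_Γ {L : CMField} (S : StubTree.SeesawDatum L) :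
    S.latticeModelW₀.Γ = Adelic.regimeRat L (Matrix.diagonal ![S.a 0, S.a 1]) := rfl

namespace Universe

/-- **Theta data with PerL's tori over the adelic unitary groups, hypothesis-free**:
`U.AdelicTorusThetaData printFact_unitaryCompact_holds`.  Reducible. -/
abbrev AdelicTorusThetaData₀ (U : Universe) : Type _ :=
  U.AdelicTorusThetaData printFact_unitaryCompact_holds

end Universe

/-! ### END STATE over the adelic unitary groups with PerL's tori — no `PrintFact_unitaryCompact` -/

namespace Assembly

open HodgeCM.PerL34 HodgeCM.PerL34.Annihilation
open HodgeCM.Prior.Perl34File HodgeCM.Prior.Perl34File.Perl34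
open HodgeCM.Universe (AdelicTorusThetaData AdelicModelThetaData LatticeModelThetaData WeilModelThetaData
  KernelModelThetaData ThetaModel)

variable (U : Universe)

/-- **Both realisation inputs of part (a)** over the adelic unitary groups with PerL's tori, the compactness
criterion DISCHARGED (`realisationExists_ofAdelicTorusData` at `hP := printFact_unitaryCompact_holds`). -/
theorem realisationExists_ofAdelicTorusData₀ (M : U.ModelAxioms) (D : U.AdelicTorusThetaData₀)
    (A12 : ∀ {L : CMField} {ι₁ : L →+* ℂ} (V : HermSpace3 L ι₁) (c : SeesawCtx L),
      QuotientTorusDatum (D.toAdelicModelThetaData.toLatticeModelThetaData.lat V c).toQuotientModel.ν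
        (D.toAdelicModelThetaData.toLatticeModelThetaData.toWeilModelThetaData.toKernelModelThetaData.kcore V
          c).toRegCoreCarrier.toRepCoreCarrier
        (D.toAdelicModelThetaData.kt12 V c).toRegTorusCarrier.toRepTorusCarrier)
    (A34 : ∀ {L : CMField} {ι₁ : L →+* ℂ} (V : HermSpace3 L ι₁) (c : SeesawCtx L),
      QuotientTorusDatum (D.toAdelicModelThetaData.toLatticeModelThetaData.lat V c).toQuotientModel.ν
        (D.toAdelicModelThetaData.toLatticeModelThetaData.toWeilModelThetaData.toKernelModelThetaData.kcore V
          c).toRegCoreCarrier.toRepCoreCarrier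
        (D.toAdelicModelThetaData.kt34 V c).toRegTorusCarrier.toRepTorusCarrier)
    (A : (ThetaModel.ofRegCarrier
      D.toAdelicModelThetaData.toLatticeModelThetaData.toWeilModelThetaData.toKernelModelThetaData.toKernelThetaCarrier.toRegThetaCarrier
      (D.toAdelicModelThetaData.toLatticeModelThetaData.analyticKM_of_quotientData A12 A34).toAnalytic).Inputs)
    (hHR : U.Fact_hodgeRiemann20) : U.RealisationExistsPerL ∧ U.RealisationExistsFace :=
  realisationExists_ofAdelicTorusData U M printFact_unitaryCompact_holds D A12 A34 A hHR

/-- **PerL over the adelic unitary groups with PerL's tori, the compactness criterion DISCHARGED.** -/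
theorem perL_ofAdelicTorusData₀ (M : U.ModelAxioms) (D : U.AdelicTorusThetaData₀)
    (A12 : ∀ {L : CMField} {ι₁ : L →+* ℂ} (V : HermSpace3 L ι₁) (c : SeesawCtx L),
      QuotientTorusDatum (D.toAdelicModelThetaData.toLatticeModelThetaData.lat V c).toQuotientModel.ν
        (D.toAdelicModelThetaData.toLatticeModelThetaData.toWeilModelThetaData.toKernelModelThetaData.kcore V
          c).toRegCoreCarrier.toRepCoreCarrier
        (D.toAdelicModelThetaData.kt12 V c).toRegTorusCarrier.toRepTorusCarrier)
    (A34 : ∀ {L : CMField} {ι₁ : L →+* ℂ} (V : HermSpace3 L ι₁) (c : SeesawCtx L),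
      QuotientTorusDatum (D.toAdelicModelThetaData.toLatticeModelThetaData.lat V c).toQuotientModel.ν
        (D.toAdelicModelThetaData.toLatticeModelThetaData.toWeilModelThetaData.toKernelModelThetaData.kcore V
          c).toRegCoreCarrier.toRepCoreCarrier
        (D.toAdelicModelThetaData.kt34 V c).toRegTorusCarrier.toRepTorusCarrier)
    (A : (ThetaModel.ofRegCarrier
      D.toAdelicModelThetaData.toLatticeModelThetaData.toWeilModelThetaData.toKernelModelThetaData.toKernelThetaCarrier.toRegThetaCarrier
      (D.toAdelicModelThetaData.toLatticeModelThetaData.analyticKM_of_quotientData A12 A34).toAnalytic).Inputs)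
    (hHR : U.Fact_hodgeRiemann20) : U.PerL :=
  perL_ofAdelicTorusData U M printFact_unitaryCompact_holds D A12 A34 A hHR

/-- **COR-CM, END STATE over the adelic unitary groups with PerL's tori, the compactness criterion
DISCHARGED**: the remaining binders are the model axioms, M29/M30, the three [QW8] facts, the theta DATA `D`
with its analytic inputs, and `Fact_hodgeRiemann20` — no group-theoretic [PRINT] input is left. -/
theorem COR_CM_endState_ofAdelicTorusData₀ (M : U.ModelAxioms) (h29 : U.Fact_weightSpan)
    (h30 : U.Fact_weightHodge) (hE : U.Qw8ExtProd) (hD : U.Qw8DualPushPull) (hMi : U.Qw8Milne)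
    (D : U.AdelicTorusThetaData₀)
    (A12 : ∀ {L : CMField} {ι₁ : L →+* ℂ} (V : HermSpace3 L ι₁) (c : SeesawCtx L),
      QuotientTorusDatum (D.toAdelicModelThetaData.toLatticeModelThetaData.lat V c).toQuotientModel.ν
        (D.toAdelicModelThetaData.toLatticeModelThetaData.toWeilModelThetaData.toKernelModelThetaData.kcore V
          c).toRegCoreCarrier.toRepCoreCarrier
        (D.toAdelicModelThetaData.kt12 V c).toRegTorusCarrier.toRepTorusCarrier)
    (A34 : ∀ {L : CMField} {ι₁ : L →+* ℂ} (V : HermSpace3 L ι₁) (c : SeesawCtx L),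
      QuotientTorusDatum (D.toAdelicModelThetaData.toLatticeModelThetaData.lat V c).toQuotientModel.ν
        (D.toAdelicModelThetaData.toLatticeModelThetaData.toWeilModelThetaData.toKernelModelThetaData.kcore V
          c).toRegCoreCarrier.toRepCoreCarrier
        (D.toAdelicModelThetaData.kt34 V c).toRegTorusCarrier.toRepTorusCarrier)
    (A : (ThetaModel.ofRegCarrier
      D.toAdelicModelThetaData.toLatticeModelThetaData.toWeilModelThetaData.toKernelModelThetaData.toKernelThetaCarrier.toRegThetaCarrier
      (D.toAdelicModelThetaData.toLatticeModelThetaData.analyticKM_of_quotientData A12 A34).toAnalytic).Inputs)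
    (hHR : U.Fact_hodgeRiemann20) : U.HC_CM :=
  COR_CM_endState_ofAdelicTorusData U M h29 h30 hE hD hMi printFact_unitaryCompact_holds D A12 A34 A hHR

end Assembly

end HodgeCM

end
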